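import Mathlib
import HarnessLib
import Summits.PneNP.PneNP.Theses.AeaCutRectangles
import Summits.PneNP.PneNP.Theorems.AeaCutRectanglesDutyRectangles
import Summits.PneNP.PneNP.Theorems.AeaCutRectanglesSparseWitnesses
import Summits.PneNP.PneNP.Theorems.AeaCutRectanglesNoSparseSupports
import Summits.PneNP.PneNP.Theorems.AeaCutRectanglesCriticalSupport
import Summits.PneNP.PneNP.Theorems.FoolingMeasure.Negative.FoolingMeasureFalseOfHalfSparseCore

/-!
# Crux `FoolingMeasure` (stmt-PneNP-19727) / kill path `NoFoolingMeasure` (stmt-PneNP-19729) — p4 g12: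
# the IMPLIED-ATOM CORE, the kill rung typed just outside the half-dense-critical (HDC) barrier

Lens «barrier inversion, typed just outside the class», applied at crux level on the KILL side.

THE BARRIER.  The landed conditional kill `foolingMeasure_false_of_halfSparseCore : HalfSparseCore → ¬ X1`
(Theorems/FoolingMeasure/Negative) certifies a support graph `G` at a cut `B` by a SUBGRAPH certificate: an edge set
`H ⊆ G[B]` with `|H| ≤ n/2` such that `G_A ∪ H` is not 3-colourable (`G_A` = the edges of `G` meeting `V ∖ B`).  Its
hypothesis `HalfSparseCore` ("every 4-critical graph has a half spanning `≤` half as many edges as vertices") is FALSE: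
the Dobrynin–Mel'nikov–Pyatkin circulant `C(12025; ±{1,563,566,1727,3632,4586})` is 12-regular, 4-edge-critical and every
`≥ n/2`-set spans `≥ 0.5558·n > n/2` of its edges (crux dir `RoundingDefectCertificate.lean`, card `rounding-defect-
criticality`: `c12025HalfDense_holds`, `G25_erase_colorable`, `not_halfSparseCore_of_hdCritical`).  For an edge-critical
`G` a subgraph certificate needs ALL of `G[B]`, so the technique class "subgraph certificates" is dead exactly on the
half-dense critical (HDC) graphs.

THE STATEMENT TYPED JUST OUTSIDE IT.  Replace "`H ⊆ G[B]`" by "`H` is IMPLIED by `G[B]`": every proper 3-colouring of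
`G[B]` is proper on the pairs of `H` (`H ⊆ cl₃(G[B])`, the implied-edge closure; edges of `G[B]` are implied, so are the
non-edges `{x,y}` that receive distinct colours in every 3-colouring of `G[B]`).  The pair `(B, H)` is still a valid
cut rectangle inside NON-3-COL — it is the DUTY RECTANGLE `dutyRect B (killSet H)` of Theorems/AeaCutRectanglesDuty-
Rectangles — and the dictionary `{(B, H) : |B| = ⌈n/2⌉, |H| ≤ n/2}` has the SAME size as before, so the same count
(`halfSparse_count_lt_one`, `C = 4`) gives:

* `total_le_of_dutyCover` — the general CERTIFICATE-DICTIONARY ENGINE: if X1's rectangle clause holds with bound `δ`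
  at the cuts of a finite dictionary of duties `(Bᵢ, Φᵢ)` and every support graph lies in some `dutyRect Bᵢ Φᵢ`, the
  total mass is `≤ #dictionary · δ`;
* `mem_dutyRect_killSet_iff` — `G ∈ dutyRect B (killSet H)` iff `G` is loopless, `H` is implied by `G[B]` and
  `G_A ∪ H` is not 3-colourable (implied-pair certificates ARE duty rectangles);
* `exists_uncertified_support` — the finite core: for `n ≥ 2`, a probability measure whose cut rectangles at the cuts
  `|B| = ⌈n/2⌉` all have mass `≤ n^{-n/2}·2^{-4n}` has a support graph with NO implied-pair certificate of size `≤ n/2`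
  at any such cut;
* `ImpliedHalfSparseCore` (IHSC: every loopless non-3-colourable `G` over `Fin n` has a cut `|B| = ⌈n/2⌉` and an
  implied `H`, `2|H| ≤ n`, with `G_A ∪ H` not 3-colourable) and its edge-critical form `ImpliedHalfSparseCoreCrit`;
  `impliedHalfSparseCore_of_halfSparseCore : HalfSparseCore → IHSC` (the new rung DOMINATES the dead one) and
  `impliedHalfSparseCore_of_crit : IHSC-crit → IHSC` (it suffices to certify 4-edge-critical graphs);
* **`foolingMeasure_false_of_impliedHalfSparseCore : IHSC → ¬ FoolingMeasure`**, its critical form, and the kill-path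
  links `noFoolingMeasure_of_impliedHalfSparseCore[_crit]` (conditional proofs of stmt-PneNP-19729);
* `BinaryAtomCore` (atoms of both signs: implied `≠` AND implied `=`, duty `killSet H ∪ sepSet (D ∖ H)`, `|D| ≤ n/2`, `C = 5`),
  the mirror CO-atom certificates (atoms implied by Alice's side, complementary duty) and the combined `AtomCore` (`C = 6`):
  `HalfSparseCore → ImpliedHalfSparseCore → BinaryAtomCore → AtomCore → ¬ FoolingMeasure` (§7, §8);
* the contrapositive as a DESIGN REQUIREMENT on the thesis side (R7 of Lines/duty-analysis-g2 §2, typed):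
  `foolingMeasure_imp_atomIncompressible` — X1 forces, for infinitely many `n`, a 4-EDGE-CRITICAL graph on `Fin n`
  admitting no implied-pair certificate of size `≤ n/2` at ANY cut of size `⌈n/2⌉` ("atom-incompressible" critical
  graphs; HDC is the special case `H ⊆ G[B]`).

Whether the HDC circulants are atom-compressible (captured by the new dictionary) is the cheapest falsifier of the new
rung; the companion memo `BarrierNotesP4g12.md` records the rotation-colouring analysis and kit job j318967.

HONEST FRAMING: conditional refutation / bookkeeping for a FRONTIER restricted-model rung (AEA cut rectangles, Fagin's
complement ladder); all statements elementary finite combinatorics; nothing here bears on P vs NP.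
-/

set_option linter.dupNamespace false
set_option autoImplicit false

namespace Summit.PneNP.PneNP.Cruxes.FoolingMeasure.P4g12

open Finset
open Summit.PneNP.PneNP.Theorems.AeaCutRectanglesDutyRectangles
open Summit.PneNP.PneNP.Theorems.AeaCutRectanglesSparseWitnesses
open Summit.PneNP.PneNP.Theorems.AeaCutRectanglesNoSparseSupports
open Summit.PneNP.PneNP.Theorems.AeaCutRectanglesCriticalSupport
open Summit.PneNP.PneNP.Theorems.FoolingMeasure.Negative

/-! ### §1  The certificate-dictionary engine (duty form) -/

section Dictionary

variable {V : Type*} [Fintype V] [DecidableEq V]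

/-- X1's rectangle clause at the cut `B` with bound `δ` (the three hypotheses of the crux verbatim). -/
def RectClause (μ : Finset (Sym2 V) → ℝ) (B : Finset V) (δ : ℝ) : Prop :=
  ∀ 𝓐 𝓑 : Finset (Finset (Sym2 V)),
    (∀ α ∈ 𝓐, ∀ e ∈ α, ¬ e.IsDiag ∧ ∃ v ∈ e, v ∉ B) →
    (∀ β ∈ 𝓑, ∀ e ∈ β, ¬ e.IsDiag ∧ ∀ v ∈ e, v ∈ B) →
    (∀ α ∈ 𝓐, ∀ β ∈ 𝓑,
      ¬ (SimpleGraph.fromEdgeSet ((α ∪ β : Finset (Sym2 V)) : Set (Sym2 V))).Colorable 3) →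
    ∑ q ∈ 𝓐 ×ˢ 𝓑, μ (q.1 ∪ q.2) ≤ δ

/-- **Certificate-dictionary engine.**  `μ ≥ 0`; a finite dictionary `I` of duties `(cut i, duty i)`; X1's clause with
bound `δ` at every `cut i`; every graph of non-zero mass lies in some `dutyRect (cut i) (duty i)`.  Then the total
mass is at most `#I · δ` (union bound + `dutySum_le_of_rectClause`). -/
theorem total_le_of_dutyCover {ι : Type*} (μ : Finset (Sym2 V) → ℝ) (hμ : ∀ S, 0 ≤ μ S)
    (I : Finset ι) (cut : ι → Finset V) (duty : ι → Set (V → Fin 3)) {δ : ℝ}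
    (hclause : ∀ i ∈ I, RectClause μ (cut i) δ)
    (hcov : ∀ S, μ S ≠ 0 → ∃ i ∈ I, S ∈ dutyRect (cut i) (duty i)) :
    ∑ S, μ S ≤ (I.card : ℝ) * δ := by
  classical
  calc ∑ S, μ S ≤ ∑ i ∈ I, ∑ S ∈ univ.filter (fun S => S ∈ dutyRect (cut i) (duty i)), μ S :=
        sum_le_sum_cover I (fun i S => S ∈ dutyRect (cut i) (duty i)) μ hμ hcov
    _ ≤ ∑ _i ∈ I, δ := by
        refine sum_le_sum fun i hi => ?_
        have hset : univ.filter (fun S => S ∈ dutyRect (cut i) (duty i)) = dutyFinset (cut i) (duty i) := by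
          ext S
          rw [mem_filter, mem_dutyFinset]
          simp
        rw [hset]
        exact dutySum_le_of_rectClause μ hμ (hclause i hi) (duty i)
    _ = (I.card : ℝ) * δ := by rw [sum_const, nsmul_eq_mul]

/-! ### §2  Implied pairs and their duty rectangles -/

/-- `H` is IMPLIED by `β` (`H ⊆ cl₃ β`): every proper 3-colouring of (the non-loop pairs of) `β` is proper on (the
non-loop pairs of) `H`.  Edges of `β` are implied; so are the non-adjacent pairs that are separated in every proper
3-colouring of `β`. -/
def Implied (β H : Finset (Sym2 V)) : Prop :=
  ∀ c : V → Fin 3, c ∉ killSet β → c ∉ killSet H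

omit [Fintype V] [DecidableEq V] in
/-- Sub-edge-sets are implied (the subgraph certificates of `HalfSparseCore` are the special case). -/
theorem implied_of_subset {β H : Finset (Sym2 V)} (h : H ⊆ β) : Implied β H :=
  fun _ hc hcH => hc (killSet_mono h hcH)

omit [Fintype V] [DecidableEq V] in
/-- Implication is monotone in the implying edge set. -/
theorem Implied.mono {β β' H : Finset (Sym2 V)} (h : Implied β H) (hβ : β ⊆ β') : Implied β' H :=
  fun c hc => h c (fun hcβ => hc (killSet_mono hβ hcβ))

omit [Fintype V] [DecidableEq V] in
/-- Implication is transitive. -/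
theorem Implied.trans {β H K : Finset (Sym2 V)} (h₁ : Implied β H) (h₂ : Implied H K) : Implied β K :=
  fun c hc => h₂ c (h₁ c hc)

/-- Duty membership through kill sets: `G ∈ dutyRect B Φ` iff `G` is loopless, its inside-`B` edges kill every
colouring of `Φ` and its edges meeting `V ∖ B` kill every colouring outside `Φ`. -/
theorem mem_dutyRect_iff_killSet {B : Finset V} {Φ : Set (V → Fin 3)} {G : Finset (Sym2 V)} :
    G ∈ dutyRect B Φ ↔ (∀ e ∈ G, ¬ e.IsDiag) ∧ (∀ c ∈ Φ, c ∈ killSet (bobSide B G)) ∧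
      (∀ c ∉ Φ, c ∈ killSet (aliceSide B G)) := by
  rw [mem_dutyRect]
  constructor
  · rintro ⟨hl, hB, hA⟩
    refine ⟨hl, fun c hc => ?_, fun c hc => ?_⟩
    · obtain ⟨e, heG, hin, hm⟩ := hB c hc
      exact ⟨e, mem_bobSide.2 ⟨heG, hin⟩, hl e heG, hm⟩
    · obtain ⟨e, heG, hout, hm⟩ := hA c hc
      exact ⟨e, mem_aliceSide.2 ⟨heG, hout⟩, hl e heG, hm⟩
  · rintro ⟨hl, hB, hA⟩
    refine ⟨hl, fun c hc => ?_, fun c hc => ?_⟩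
    · obtain ⟨e, he, -, hm⟩ := hB c hc
      obtain ⟨heG, hin⟩ := mem_bobSide.1 he
      exact ⟨e, heG, hin, hm⟩
    · obtain ⟨e, he, -, hm⟩ := hA c hc
      obtain ⟨heG, hout⟩ := mem_aliceSide.1 he
      exact ⟨e, heG, hout, hm⟩

/-- The colourings SEPARATING some pair of `E` (its two ends get distinct colours). -/
def sepSet (E : Finset (Sym2 V)) : Set (V → Fin 3) := {c | ∃ e ∈ E, ¬ (e.map c).IsDiag}

omit [Fintype V] [DecidableEq V] in
theorem sepSet_mono {E E' : Finset (Sym2 V)} (h : E ⊆ E') : sepSet E ⊆ sepSet E' :=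
  fun _ ⟨e, he, hc⟩ => ⟨e, h he, hc⟩

omit [Fintype V] [DecidableEq V] in
@[simp] theorem sepSet_empty : sepSet (∅ : Finset (Sym2 V)) = ∅ := by
  ext c
  simp [sepSet]

/-- **Implied-pair certificates are duty rectangles.**  `G ∈ dutyRect B (killSet H)` iff `G` is loopless, `H` is
implied by `G[B] = bobSide B G`, and `aliceSide B G ∪ H` is not 3-colourable. -/
theorem mem_dutyRect_killSet_iff {B : Finset V} {H G : Finset (Sym2 V)} :
    G ∈ dutyRect B (killSet H) ↔ (∀ e ∈ G, ¬ e.IsDiag) ∧ Implied (bobSide B G) H ∧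
      ¬ (SimpleGraph.fromEdgeSet ((aliceSide B G ∪ H : Finset (Sym2 V)) : Set (Sym2 V))).Colorable 3 := by
  rw [mem_dutyRect, not_colorable_iff_forall_mem_killSet]
  constructor
  · rintro ⟨hl, hB, hA⟩
    refine ⟨hl, ?_, ?_⟩
    · intro c hc hcH
      obtain ⟨e, heG, hin, hm⟩ := hB c hcH
      exact hc ⟨e, mem_bobSide.2 ⟨heG, hin⟩, hl e heG, hm⟩
    · intro c
      by_cases hcH : c ∈ killSet H
      · exact killSet_mono subset_union_right hcH
      · obtain ⟨e, heG, hout, hm⟩ := hA c hcH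
        exact killSet_mono subset_union_left ⟨e, mem_aliceSide.2 ⟨heG, hout⟩, hl e heG, hm⟩
  · rintro ⟨hl, hI, hA⟩
    refine ⟨hl, ?_, ?_⟩
    · intro c hcH
      by_contra hne
      push Not at hne
      apply hI c ?_ hcH
      rintro ⟨e, he, -, hm⟩
      obtain ⟨heG, hin⟩ := mem_bobSide.1 he
      exact hne e heG hin hm
    · intro c hcH
      rcases mem_killSet_union (hA c) with h | h
      · obtain ⟨e, he, -, hm⟩ := h
        obtain ⟨heG, hout⟩ := mem_aliceSide.1 he
        exact ⟨e, heG, hout, hm⟩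
      · exact absurd h hcH

end Dictionary

/-! ### §3  The hypotheses: implied half-sparse cores -/

/-- 3-colourability of the graph of an edge set over `Fin n` (local abbreviation). -/
abbrev Col3 {n : ℕ} (G : Finset (Sym2 (Fin n))) : Prop :=
  (SimpleGraph.fromEdgeSet (G : Set (Sym2 (Fin n)))).Colorable 3

/-- An IMPLIED-PAIR CERTIFICATE of size `≤ n/2` for `G` at the cut `B`: a pair set `H` with `2|H| ≤ n`, implied by
`G[B]`, such that `aliceSide B G ∪ H` is not 3-colourable. -/
def HasCertificate {n : ℕ} (G : Finset (Sym2 (Fin n))) (B : Finset (Fin n)) : Prop :=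
  ∃ H : Finset (Sym2 (Fin n)), 2 * H.card ≤ n ∧ Implied (bobSide B G) H ∧ ¬ Col3 (aliceSide B G ∪ H)

/-- **IMPLIED HALF-SPARSE CORE (IHSC).**  Every loopless non-3-colourable edge set over `Fin n` has a cut `B` of size
`⌈n/2⌉` (`n ≤ 2|B| ≤ n+1`) carrying an implied-pair certificate of size `≤ n/2`.  `HalfSparseCore` is the special
case "`H ⊆ G[B]`" (`impliedHalfSparseCore_of_halfSparseCore`).  OPEN; the half-dense critical circulants that refute
`HalfSparseCore` are its first test (memo BarrierNotesP4g12.md). -/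
def ImpliedHalfSparseCore : Prop :=
  ∀ (n : ℕ) (G : Finset (Sym2 (Fin n))), (∀ e ∈ G, ¬ e.IsDiag) → ¬ Col3 G →
    ∃ B : Finset (Fin n), n ≤ 2 * B.card ∧ 2 * B.card ≤ n + 1 ∧ HasCertificate G B

/-- The same hypothesis restricted to 4-EDGE-CRITICAL edge sets (it implies the unrestricted one,
`impliedHalfSparseCore_of_crit`). -/
def ImpliedHalfSparseCoreCrit : Prop :=
  ∀ (n : ℕ) (G : Finset (Sym2 (Fin n))), IsEdgeCritical G →
    ∃ B : Finset (Fin n), n ≤ 2 * B.card ∧ 2 * B.card ≤ n + 1 ∧ HasCertificate G B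

/-- Certificates lift from a subgraph to the graph (same cut, same `H`). -/
theorem HasCertificate.mono {n : ℕ} {T G : Finset (Sym2 (Fin n))} {B : Finset (Fin n)}
    (h : HasCertificate T B) (hTG : T ⊆ G) : HasCertificate G B := by
  obtain ⟨H, hcard, hI, hA⟩ := h
  refine ⟨H, hcard, hI.mono (bobSide_mono B hTG), ?_⟩
  exact not_colorable_of_subset (union_subset_union (aliceSide_mono B hTG) (Subset.refl _)) hA

/-- **The new rung dominates the dead one**: `HalfSparseCore → ImpliedHalfSparseCore` (shrink the sparse half to a
set of size `⌈n/2⌉` inside it and take `H = F[B]`, a sub-edge-set of `G[B]`, hence implied). -/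
theorem impliedHalfSparseCore_of_halfSparseCore (hH : HalfSparseCore) : ImpliedHalfSparseCore := by
  intro n G hl hc
  obtain ⟨S, hS, F, hFG, hF, hsparse⟩ := hH n G hl hc
  obtain ⟨B, hBS, hBcard⟩ := exists_subset_card_eq (show (n + 1) / 2 ≤ S.card by omega)
  refine ⟨B, by omega, by omega, bobSide B F, ?_, ?_, ?_⟩
  · have := card_le_card (bobSide_mono_left hBS F)
    omega
  · exact implied_of_subset (bobSide_mono B hFG)
  · exact not_colorable_of_subset (subset_aliceSide_union_bobSide B hFG) hF

/-- **It suffices to certify 4-edge-critical graphs**: every loopless non-3-colourable edge set contains an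
edge-critical one (`exists_critical_subset`), and certificates lift (`HasCertificate.mono`). -/
theorem impliedHalfSparseCore_of_crit (hH : ImpliedHalfSparseCoreCrit) : ImpliedHalfSparseCore := by
  intro n G hl hc
  obtain ⟨T, hTG, hT⟩ := exists_critical_subset G hl hc
  obtain ⟨B, h1, h2, hcert⟩ := hH n T hT
  exact ⟨B, h1, h2, hcert.mono hTG⟩

/-! ### §4  The finite core: a light measure has an uncertified (indeed uncertified critical) support graph -/

/-- **Finite core.**  For `n ≥ 2`, a probability measure on loopless non-3-colourable edge sets over `Fin n` whose
cut rectangles at every cut of size `⌈n/2⌉` have mass `≤ 2^{-(n/2)·log₂ n - 4n}` has a support graph admitting NO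
implied-pair certificate of size `≤ n/2` at any cut of size `⌈n/2⌉`.  (Union bound over the `≤ 2^n·(n/2+1)·C(N, n/2)`
duty rectangles `dutyRect B (killSet H)`; `halfSparse_count_lt_one`.) -/
theorem exists_uncertified_support {n : ℕ} (hn : 2 ≤ n) (μ : Finset (Sym2 (Fin n)) → ℝ)
    (hμ : ∀ S, 0 ≤ μ S) (hsum : ∑ S, μ S = 1)
    (hs : ∀ S, μ S ≠ 0 → (∀ e ∈ S, ¬ e.IsDiag) ∧ ¬ Col3 S)
    (hX : ∀ B : Finset (Fin n), n ≤ 2 * B.card → 2 * B.card ≤ n + 1 →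
      RectClause μ B ((2 : ℝ) ^ (-((n : ℝ) / 2 * Real.logb 2 n) - ((4 : ℕ) : ℝ) * n))) :
    ∃ S, μ S ≠ 0 ∧ ∀ B : Finset (Fin n), n ≤ 2 * B.card → 2 * B.card ≤ n + 1 → ¬ HasCertificate S B := by
  classical
  by_contra hall
  push Not at hall
  set δ : ℝ := (2 : ℝ) ^ (-((n : ℝ) / 2 * Real.logb 2 n) - ((4 : ℕ) : ℝ) * n) with hδ
  have hδpos : 0 < δ := Real.rpow_pos_of_pos (by norm_num) _
  set m : ℕ := n / 2 with hm
  set P : Finset (Finset (Sym2 (Fin n))) := univ.filter (fun H => H.card ≤ m) with hP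
  set Wset : Finset (Finset (Fin n)) := univ.filter (fun B => n ≤ 2 * B.card ∧ 2 * B.card ≤ n + 1) with hW
  set I : Finset (Finset (Fin n) × Finset (Sym2 (Fin n))) := Wset ×ˢ P with hI
  -- every support graph is covered by a dictionary duty rectangle
  have hcov : ∀ S, μ S ≠ 0 → ∃ i ∈ I, S ∈ dutyRect i.1 (killSet i.2) := by
    intro S hS
    obtain ⟨B, h1, h2, H, hcard, hI', hA⟩ := hall S hS
    refine ⟨(B, H), mem_product.2 ⟨mem_filter.2 ⟨mem_univ _, h1, h2⟩,
      mem_filter.2 ⟨mem_univ _, (show H.card ≤ m by omega)⟩⟩, ?_⟩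
    exact mem_dutyRect_killSet_iff.2 ⟨(hs S hS).1, hI', hA⟩
  have htot := total_le_of_dutyCover μ hμ I Prod.fst (fun i => killSet i.2)
    (fun i hi => by
      obtain ⟨hB, -⟩ := mem_product.1 hi
      obtain ⟨-, h1, h2⟩ := mem_filter.1 hB
      exact hX i.1 h1 h2) hcov
  rw [hsum] at htot
  -- count
  have hIcard : (I.card : ℝ) ≤ ((2 ^ n : ℕ) : ℝ) *
      (((n / 2 + 1) * (Fintype.card (Sym2 (Fin n))).choose (n / 2) : ℕ) : ℝ) := by
    have hWc : Wset.card ≤ 2 ^ n := by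
      calc Wset.card ≤ (univ : Finset (Finset (Fin n))).card := card_le_card (filter_subset _ _)
        _ = 2 ^ n := by rw [card_univ, Fintype.card_finset, Fintype.card_fin]
    have hPc : P.card ≤ (n / 2 + 1) * (Fintype.card (Sym2 (Fin n))).choose (n / 2) :=
      card_filter_card_le_choose (Sym2 (Fin n)) m
        ((show 2 * m ≤ n by omega).trans (le_card_sym2_fin (by omega)))
    rw [hI, card_product]
    exact_mod_cast Nat.mul_le_mul hWc hPc
  have hlt := halfSparse_count_lt_one hn
  rw [← hδ] at hlt
  have := mul_le_mul_of_nonneg_right hIcard hδpos.le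
  nlinarith

/-- The uncertified support may be taken 4-EDGE-CRITICAL (pass to a critical sub-edge-set; certificates lift). -/
theorem exists_uncertified_critical {n : ℕ} (hn : 2 ≤ n) (μ : Finset (Sym2 (Fin n)) → ℝ)
    (hμ : ∀ S, 0 ≤ μ S) (hsum : ∑ S, μ S = 1)
    (hs : ∀ S, μ S ≠ 0 → (∀ e ∈ S, ¬ e.IsDiag) ∧ ¬ Col3 S)
    (hX : ∀ B : Finset (Fin n), n ≤ 2 * B.card → 2 * B.card ≤ n + 1 →
      RectClause μ B ((2 : ℝ) ^ (-((n : ℝ) / 2 * Real.logb 2 n) - ((4 : ℕ) : ℝ) * n))) :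
    ∃ T : Finset (Sym2 (Fin n)), IsEdgeCritical T ∧
      ∀ B : Finset (Fin n), n ≤ 2 * B.card → 2 * B.card ≤ n + 1 → ¬ HasCertificate T B := by
  obtain ⟨S, hS, hno⟩ := exists_uncertified_support hn μ hμ hsum hs hX
  obtain ⟨T, hTS, hT⟩ := exists_critical_subset S (hs S hS).1 (hs S hS).2
  exact ⟨T, hT, fun B h1 h2 hc => hno B h1 h2 (hc.mono hTS)⟩

/-! ### §5  The conditional refutation of X1 and the kill path -/

/-- From X1: for every `C` and `N` some `n ≥ N`, `n ≥ 2`, carries a measure satisfying the clause with bound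
`2^{-(n/2)·log₂ n - C·n}` at every cut of size `⌈n/2⌉` (those cuts lie in the window once `ε·n ≥ 1`). -/
theorem foolingMeasure_schedule (hX1 : Summit.PneNP.PneNP.Theses.AeaCutRectangles.FoolingMeasure) (C N : ℕ) :
    ∃ n, N ≤ n ∧ 2 ≤ n ∧ ∃ μ : Finset (Sym2 (Fin n)) → ℝ, (∀ S, 0 ≤ μ S) ∧ (∑ S, μ S = 1) ∧
      (∀ S, μ S ≠ 0 → (∀ e ∈ S, ¬ e.IsDiag) ∧ ¬ Col3 S) ∧
      ∀ B : Finset (Fin n), n ≤ 2 * B.card → 2 * B.card ≤ n + 1 →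
        RectClause μ B ((2 : ℝ) ^ (-((n : ℝ) / 2 * Real.logb 2 n) - ((C : ℕ) : ℝ) * n)) := by
  obtain ⟨ε, hε0, -, hC⟩ := hX1
  obtain ⟨N₀, hN₀⟩ := exists_nat_gt (1 / ε)
  obtain ⟨n, hnN, μ, hμ, hsum, hs, hX⟩ := Filter.frequently_atTop.1 (hC C) (N₀ + N + 2)
  have hnε : (1 : ℝ) ≤ ε * n := by
    have hNn : (N₀ : ℝ) ≤ n := by exact_mod_cast (show N₀ ≤ n by omega)
    have h := mul_le_mul_of_nonneg_left hNn hε0.le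
    have h' : 1 < ε * N₀ := by
      rw [div_lt_iff₀ hε0] at hN₀
      linarith
    linarith
  refine ⟨n, by omega, by omega, μ, hμ, hsum, hs, fun B h1 h2 => ?_⟩
  have h1' : (n : ℝ) ≤ 2 * (B.card : ℝ) := by exact_mod_cast h1
  have h2' : 2 * (B.card : ℝ) ≤ n + 1 := by exact_mod_cast h2
  exact hX B (by nlinarith) (by nlinarith)

/-- **X1 IS FALSE UNDER THE IMPLIED-HALF-SPARSE-CORE HYPOTHESIS.**  If every loopless non-3-colourable edge set over
`Fin n` carries an implied-pair certificate of size `≤ n/2` at some cut of size `⌈n/2⌉` (`ImpliedHalfSparseCore`;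
implied by the refuted-in-general but family-wise true `HalfSparseCore`, and not refuted by the half-dense critical
circulants as such), then `Summit.PneNP.PneNP.Theses.AeaCutRectangles.FoolingMeasure` fails. -/
theorem foolingMeasure_false_of_impliedHalfSparseCore (hH : ImpliedHalfSparseCore) :
    ¬ Summit.PneNP.PneNP.Theses.AeaCutRectangles.FoolingMeasure := by
  intro hX1
  obtain ⟨n, -, hn2, μ, hμ, hsum, hs, hX⟩ := foolingMeasure_schedule hX1 4 0
  obtain ⟨S, hS, hno⟩ := exists_uncertified_support hn2 μ hμ hsum hs hX
  obtain ⟨B, h1, h2, hcert⟩ := hH n S (hs S hS).1 (hs S hS).2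
  exact hno B h1 h2 hcert

/-- The same with the weaker (critical-only) hypothesis. -/
theorem foolingMeasure_false_of_impliedHalfSparseCoreCrit (hH : ImpliedHalfSparseCoreCrit) :
    ¬ Summit.PneNP.PneNP.Theses.AeaCutRectangles.FoolingMeasure :=
  foolingMeasure_false_of_impliedHalfSparseCore (impliedHalfSparseCore_of_crit hH)

/-- **Kill path (stmt-PneNP-19729) under IHSC.** -/
theorem noFoolingMeasure_of_impliedHalfSparseCore (hH : ImpliedHalfSparseCore) :
    Summit.PneNP.PneNP.Theses.AeaCutRectangles.NoFoolingMeasure := by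
  unfold Summit.PneNP.PneNP.Theses.AeaCutRectangles.NoFoolingMeasure
  exact foolingMeasure_false_of_impliedHalfSparseCore hH

/-- **Kill path (stmt-PneNP-19729) under IHSC for 4-edge-critical graphs.** -/
theorem noFoolingMeasure_of_impliedHalfSparseCoreCrit (hH : ImpliedHalfSparseCoreCrit) :
    Summit.PneNP.PneNP.Theses.AeaCutRectangles.NoFoolingMeasure :=
  noFoolingMeasure_of_impliedHalfSparseCore (impliedHalfSparseCore_of_crit hH)

/-! ### §6  The contrapositive as a design requirement (R7 typed): X1 needs atom-incompressible critical graphs -/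

/-- **X1 ⇒ ATOM-INCOMPRESSIBLE 4-CRITICAL GRAPHS EXIST for infinitely many `n`.**  If `FoolingMeasure` holds then
for every `N` there are `n ≥ N` and a 4-edge-critical edge set `T` over `Fin n` such that NO cut `B` of size `⌈n/2⌉`
admits a pair set `H`, `2|H| ≤ n`, implied by `T[B]` with `T_A ∪ H` non-3-colourable.  (Half-density — every
`⌈n/2⌉`-set spanning `> n/2` edges of `T` — is the sub-case `H ⊆ T[B]`; the requirement here is strictly stronger.) -/
theorem foolingMeasure_imp_atomIncompressible
    (hX1 : Summit.PneNP.PneNP.Theses.AeaCutRectangles.FoolingMeasure) (N : ℕ) :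
    ∃ n, N ≤ n ∧ ∃ T : Finset (Sym2 (Fin n)), IsEdgeCritical T ∧
      ∀ B : Finset (Fin n), n ≤ 2 * B.card → 2 * B.card ≤ n + 1 → ¬ HasCertificate T B := by
  obtain ⟨n, hnN, hn2, μ, hμ, hsum, hs, hX⟩ := foolingMeasure_schedule hX1 4 N
  obtain ⟨T, hT, hno⟩ := exists_uncertified_critical hn2 μ hμ hsum hs hX
  exact ⟨n, hnN, T, hT, hno⟩

/-- In particular an atom-incompressible critical `T` is HALF-DENSE: every cut of size `⌈n/2⌉` spans MORE than `n/2`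
of its edges (else `H = T[B]` is a certificate, `T_A ∪ T[B] = T`). -/
theorem halfDense_of_noCertificate {n : ℕ} {T : Finset (Sym2 (Fin n))} (hT : IsEdgeCritical T)
    {B : Finset (Fin n)} (hno : ¬ HasCertificate T B) : n < 2 * (bobSide B T).card := by
  by_contra hle
  push Not at hle
  apply hno
  refine ⟨bobSide B T, hle, implied_of_subset (Subset.refl _), ?_⟩
  rw [aliceSide_union_bobSide]
  exact hT.2.1


/-! ### §7  Binary atoms of BOTH kinds: implied inequalities and implied equalities

A BINARY-ATOM certificate at `B` is a set `D` of at most `n/2` vertex pairs, each labelled `≠` (the sub-set `H ⊆ D`) or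
`=` (`D ∖ H`), with duty `Φ = killSet H ∪ sepSet (D ∖ H)`: Bob's inside edges kill every colouring that is improper on an
`≠`-atom or separates an `=`-atom (i.e. every proper 3-colouring of `G[B]` satisfies all the atoms — they are IMPLIED),
and Alice's edges kill every colouring satisfying all atoms (i.e. `G_A` plus the `≠`-atoms, with the `=`-atoms
identified, is not 3-colourable).  The dictionary grows by the label factor `2^{n/2} ≤ 2^n`, absorbed by taking `C = 5`. -/

/-- A binary-atom certificate of size `≤ n/2` for `G` at the cut `B` (see the section docstring). -/
def HasBinaryCertificate {n : ℕ} (G : Finset (Sym2 (Fin n))) (B : Finset (Fin n)) : Prop :=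
  ∃ D H : Finset (Sym2 (Fin n)), H ⊆ D ∧ 2 * D.card ≤ n ∧
    (∀ c ∈ killSet H ∪ sepSet (D \ H), c ∈ killSet (bobSide B G)) ∧
    (∀ c ∉ killSet H ∪ sepSet (D \ H), c ∈ killSet (aliceSide B G))

/-- Implied-pair certificates are binary-atom certificates (all atoms labelled `≠`). -/
theorem HasCertificate.binary {n : ℕ} {G : Finset (Sym2 (Fin n))} {B : Finset (Fin n)}
    (h : HasCertificate G B) : HasBinaryCertificate G B := by
  obtain ⟨H, hcard, hI, hA⟩ := h
  rw [not_colorable_iff_forall_mem_killSet] at hA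
  refine ⟨H, H, Subset.refl _, hcard, fun c hc => ?_, fun c hc => ?_⟩
  · rw [sdiff_self, Finset.bot_eq_empty, sepSet_empty, Set.union_empty] at hc
    by_contra hcb
    exact hI c hcb hc
  · rw [sdiff_self, Finset.bot_eq_empty, sepSet_empty, Set.union_empty] at hc
    rcases mem_killSet_union (hA c) with h | h
    · exact h
    · exact absurd h hc

/-- Binary certificates lift from a subgraph to the graph. -/
theorem HasBinaryCertificate.mono {n : ℕ} {T G : Finset (Sym2 (Fin n))} {B : Finset (Fin n)}
    (h : HasBinaryCertificate T B) (hTG : T ⊆ G) : HasBinaryCertificate G B := by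
  obtain ⟨D, H, hHD, hcard, hB, hA⟩ := h
  exact ⟨D, H, hHD, hcard, fun c hc => killSet_mono (bobSide_mono B hTG) (hB c hc),
    fun c hc => killSet_mono (aliceSide_mono B hTG) (hA c hc)⟩

/-- **BINARY-ATOM CORE (BAC).**  Every loopless non-3-colourable edge set over `Fin n` has a cut of size `⌈n/2⌉`
carrying a binary-atom certificate of size `≤ n/2`.  Implied by `ImpliedHalfSparseCore` (hence by `HalfSparseCore`). -/
def BinaryAtomCore : Prop :=
  ∀ (n : ℕ) (G : Finset (Sym2 (Fin n))), (∀ e ∈ G, ¬ e.IsDiag) → ¬ Col3 G →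
    ∃ B : Finset (Fin n), n ≤ 2 * B.card ∧ 2 * B.card ≤ n + 1 ∧ HasBinaryCertificate G B

/-- BAC restricted to 4-edge-critical edge sets. -/
def BinaryAtomCoreCrit : Prop :=
  ∀ (n : ℕ) (G : Finset (Sym2 (Fin n))), IsEdgeCritical G →
    ∃ B : Finset (Fin n), n ≤ 2 * B.card ∧ 2 * B.card ≤ n + 1 ∧ HasBinaryCertificate G B

theorem binaryAtomCore_of_impliedHalfSparseCore (h : ImpliedHalfSparseCore) : BinaryAtomCore := by
  intro n G hl hc
  obtain ⟨B, h1, h2, hcert⟩ := h n G hl hc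
  exact ⟨B, h1, h2, hcert.binary⟩

theorem binaryAtomCore_of_crit (h : BinaryAtomCoreCrit) : BinaryAtomCore := by
  intro n G hl hc
  obtain ⟨T, hTG, hT⟩ := exists_critical_subset G hl hc
  obtain ⟨B, h1, h2, hcert⟩ := h n T hT
  exact ⟨B, h1, h2, hcert.mono hTG⟩

/-- `2^{-(n/2)·log₂ n - 5n} = 2^{-(n/2)·log₂ n - 4n} · 2^{-n}`. -/
theorem delta_five_eq (n : ℕ) :
    (2 : ℝ) ^ (-((n : ℝ) / 2 * Real.logb 2 n) - ((5 : ℕ) : ℝ) * n) =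
      (2 : ℝ) ^ (-((n : ℝ) / 2 * Real.logb 2 n) - ((4 : ℕ) : ℝ) * n) * (2 : ℝ) ^ (-(n : ℝ)) := by
  rw [← Real.rpow_add (by norm_num : (0 : ℝ) < 2)]
  congr 1
  push_cast
  ring

/-- **Finite core, binary form** (`C = 5`). -/
theorem exists_binary_uncertified_support {n : ℕ} (hn : 2 ≤ n) (μ : Finset (Sym2 (Fin n)) → ℝ)
    (hμ : ∀ S, 0 ≤ μ S) (hsum : ∑ S, μ S = 1)
    (hs : ∀ S, μ S ≠ 0 → (∀ e ∈ S, ¬ e.IsDiag) ∧ ¬ Col3 S)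
    (hX : ∀ B : Finset (Fin n), n ≤ 2 * B.card → 2 * B.card ≤ n + 1 →
      RectClause μ B ((2 : ℝ) ^ (-((n : ℝ) / 2 * Real.logb 2 n) - ((5 : ℕ) : ℝ) * n))) :
    ∃ S, μ S ≠ 0 ∧ ∀ B : Finset (Fin n), n ≤ 2 * B.card → 2 * B.card ≤ n + 1 →
      ¬ HasBinaryCertificate S B := by
  classical
  by_contra hall
  push Not at hall
  set δ : ℝ := (2 : ℝ) ^ (-((n : ℝ) / 2 * Real.logb 2 n) - ((5 : ℕ) : ℝ) * n) with hδ
  have hδpos : 0 < δ := Real.rpow_pos_of_pos (by norm_num) _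
  set m : ℕ := n / 2 with hm
  set P : Finset (Finset (Sym2 (Fin n))) := univ.filter (fun D => D.card ≤ m) with hP
  set J : Finset (Finset (Sym2 (Fin n)) × Finset (Sym2 (Fin n))) :=
    P.biUnion (fun D => D.powerset.image (fun H => (D, H))) with hJ
  set Wset : Finset (Finset (Fin n)) := univ.filter (fun B => n ≤ 2 * B.card ∧ 2 * B.card ≤ n + 1) with hW
  set I := Wset ×ˢ J with hI
  have hcov : ∀ S, μ S ≠ 0 → ∃ i ∈ I, S ∈ dutyRect i.1 (killSet i.2.2 ∪ sepSet (i.2.1 \ i.2.2)) := by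
    intro S hS
    obtain ⟨B, h1, h2, D, H, hHD, hcard, hB', hA'⟩ := hall S hS
    refine ⟨(B, (D, H)), mem_product.2 ⟨mem_filter.2 ⟨mem_univ _, h1, h2⟩, ?_⟩, ?_⟩
    · rw [hJ, mem_biUnion]
      exact ⟨D, mem_filter.2 ⟨mem_univ _, (show D.card ≤ m by omega)⟩,
        mem_image.2 ⟨H, mem_powerset.2 hHD, rfl⟩⟩
    · exact mem_dutyRect_iff_killSet.2 ⟨(hs S hS).1, hB', hA'⟩
  have htot := total_le_of_dutyCover μ hμ I Prod.fst (fun i => killSet i.2.2 ∪ sepSet (i.2.1 \ i.2.2))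
    (fun i hi => by
      obtain ⟨hB, -⟩ := mem_product.1 hi
      obtain ⟨-, h1, h2⟩ := mem_filter.1 hB
      exact hX i.1 h1 h2) hcov
  rw [hsum] at htot
  -- count: #I ≤ 2^n · (#P-bound) · 2^m
  have hWc : Wset.card ≤ 2 ^ n := by
    calc Wset.card ≤ (univ : Finset (Finset (Fin n))).card := card_le_card (filter_subset _ _)
      _ = 2 ^ n := by rw [card_univ, Fintype.card_finset, Fintype.card_fin]
  have hPc : P.card ≤ (n / 2 + 1) * (Fintype.card (Sym2 (Fin n))).choose (n / 2) :=
    card_filter_card_le_choose (Sym2 (Fin n)) m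
      ((show 2 * m ≤ n by omega).trans (le_card_sym2_fin (by omega)))
  have hJc : J.card ≤ P.card * 2 ^ m := by
    calc J.card ≤ ∑ D ∈ P, (D.powerset.image (fun H => (D, H))).card := card_biUnion_le
      _ ≤ ∑ _D ∈ P, 2 ^ m := by
          refine sum_le_sum fun D hD => ?_
          calc (D.powerset.image (fun H => (D, H))).card ≤ D.powerset.card := card_image_le
            _ = 2 ^ D.card := card_powerset D
            _ ≤ 2 ^ m := Nat.pow_le_pow_right (by norm_num) (mem_filter.1 hD).2
      _ = P.card * 2 ^ m := by rw [sum_const, smul_eq_mul]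
  have hIcard : (I.card : ℝ) ≤ ((2 ^ n : ℕ) : ℝ) *
      (((n / 2 + 1) * (Fintype.card (Sym2 (Fin n))).choose (n / 2) : ℕ) : ℝ) * ((2 ^ m : ℕ) : ℝ) := by
    rw [hI, card_product]
    have : Wset.card * J.card ≤ 2 ^ n * (((n / 2 + 1) * (Fintype.card (Sym2 (Fin n))).choose (n / 2)) * 2 ^ m) :=
      Nat.mul_le_mul hWc (hJc.trans (Nat.mul_le_mul_right _ hPc))
    have := (Nat.cast_le (α := ℝ)).2 this
    push_cast at this ⊢
    linarith
  have hlt := halfSparse_count_lt_one hn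
  -- 2^m · 2^{-n} ≤ 1
  have hmn : ((2 ^ m : ℕ) : ℝ) * (2 : ℝ) ^ (-(n : ℝ)) ≤ 1 := by
    have h1 : ((2 ^ m : ℕ) : ℝ) = (2 : ℝ) ^ ((m : ℕ) : ℝ) := by
      rw [Real.rpow_natCast]; push_cast; ring
    rw [h1, ← Real.rpow_add (by norm_num : (0 : ℝ) < 2)]
    calc (2 : ℝ) ^ ((m : ℝ) + -(n : ℝ)) ≤ (2 : ℝ) ^ (0 : ℝ) :=
          Real.rpow_le_rpow_of_exponent_le (by norm_num) (by
            have : (m : ℝ) ≤ n := by exact_mod_cast (show m ≤ n by omega)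
            linarith)
      _ = 1 := Real.rpow_zero _
  have hδeq : δ = (2 : ℝ) ^ (-((n : ℝ) / 2 * Real.logb 2 n) - ((4 : ℕ) : ℝ) * n) * (2 : ℝ) ^ (-(n : ℝ)) :=
    delta_five_eq n
  set δ₄ : ℝ := (2 : ℝ) ^ (-((n : ℝ) / 2 * Real.logb 2 n) - ((4 : ℕ) : ℝ) * n) with hδ₄
  have hδ₄pos : 0 < δ₄ := Real.rpow_pos_of_pos (by norm_num) _
  have h2n : 0 < (2 : ℝ) ^ (-(n : ℝ)) := Real.rpow_pos_of_pos (by norm_num) _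
  set A : ℝ := ((2 ^ n : ℕ) : ℝ) * (((n / 2 + 1) * (Fintype.card (Sym2 (Fin n))).choose (n / 2) : ℕ) : ℝ) with hA
  have hApos : 0 ≤ A := by positivity
  -- 1 ≤ #I·δ ≤ (A·2^m)·δ₄·2^{-n} = (A·δ₄)·(2^m·2^{-n}) < 1
  have key : (I.card : ℝ) * δ ≤ (A * δ₄) * (((2 ^ m : ℕ) : ℝ) * (2 : ℝ) ^ (-(n : ℝ))) := by
    rw [hδeq]
    have := mul_le_mul_of_nonneg_right hIcard (mul_pos hδ₄pos h2n).le
    calc (I.card : ℝ) * (δ₄ * (2 : ℝ) ^ (-(n : ℝ)))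
        ≤ A * ((2 ^ m : ℕ) : ℝ) * (δ₄ * (2 : ℝ) ^ (-(n : ℝ))) := this
      _ = (A * δ₄) * (((2 ^ m : ℕ) : ℝ) * (2 : ℝ) ^ (-(n : ℝ))) := by ring
  have hfin : (A * δ₄) * (((2 ^ m : ℕ) : ℝ) * (2 : ℝ) ^ (-(n : ℝ))) < 1 := by
    calc (A * δ₄) * (((2 ^ m : ℕ) : ℝ) * (2 : ℝ) ^ (-(n : ℝ))) ≤ (A * δ₄) * 1 :=
          mul_le_mul_of_nonneg_left hmn (mul_nonneg hApos hδ₄pos.le)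
      _ < 1 := by rw [mul_one, hA, mul_assoc]; exact hlt
  linarith

/-- **X1 IS FALSE UNDER THE BINARY-ATOM-CORE HYPOTHESIS** (the widest rung of this file:
`HalfSparseCore → ImpliedHalfSparseCore → BinaryAtomCore → ¬ FoolingMeasure`). -/
theorem foolingMeasure_false_of_binaryAtomCore (hH : BinaryAtomCore) :
    ¬ Summit.PneNP.PneNP.Theses.AeaCutRectangles.FoolingMeasure := by
  intro hX1
  obtain ⟨n, -, hn2, μ, hμ, hsum, hs, hX⟩ := foolingMeasure_schedule hX1 5 0
  obtain ⟨S, hS, hno⟩ := exists_binary_uncertified_support hn2 μ hμ hsum hs hX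
  obtain ⟨B, h1, h2, hcert⟩ := hH n S (hs S hS).1 (hs S hS).2
  exact hno B h1 h2 hcert

theorem foolingMeasure_false_of_binaryAtomCoreCrit (hH : BinaryAtomCoreCrit) :
    ¬ Summit.PneNP.PneNP.Theses.AeaCutRectangles.FoolingMeasure :=
  foolingMeasure_false_of_binaryAtomCore (binaryAtomCore_of_crit hH)

/-- **Kill path (stmt-PneNP-19729) under BAC.** -/
theorem noFoolingMeasure_of_binaryAtomCore (hH : BinaryAtomCore) :
    Summit.PneNP.PneNP.Theses.AeaCutRectangles.NoFoolingMeasure := by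
  unfold Summit.PneNP.PneNP.Theses.AeaCutRectangles.NoFoolingMeasure
  exact foolingMeasure_false_of_binaryAtomCore hH

theorem noFoolingMeasure_of_binaryAtomCoreCrit (hH : BinaryAtomCoreCrit) :
    Summit.PneNP.PneNP.Theses.AeaCutRectangles.NoFoolingMeasure :=
  noFoolingMeasure_of_binaryAtomCore (binaryAtomCore_of_crit hH)

/-- **Design requirement, binary form**: X1 forces, for infinitely many `n`, 4-edge-critical graphs on `Fin n` with
NO binary-atom certificate of size `≤ n/2` at any cut of size `⌈n/2⌉`. -/
theorem foolingMeasure_imp_binaryIncompressible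
    (hX1 : Summit.PneNP.PneNP.Theses.AeaCutRectangles.FoolingMeasure) (N : ℕ) :
    ∃ n, N ≤ n ∧ ∃ T : Finset (Sym2 (Fin n)), IsEdgeCritical T ∧
      ∀ B : Finset (Fin n), n ≤ 2 * B.card → 2 * B.card ≤ n + 1 → ¬ HasBinaryCertificate T B := by
  obtain ⟨n, hnN, hn2, μ, hμ, hsum, hs, hX⟩ := foolingMeasure_schedule hX1 5 N
  obtain ⟨S, hS, hno⟩ := exists_binary_uncertified_support hn2 μ hμ hsum hs hX
  obtain ⟨T, hTS, hT⟩ := exists_critical_subset S (hs S hS).1 (hs S hS).2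
  exact ⟨n, hnN, T, hT, fun B h1 h2 hc => hno B h1 h2 (hc.mono hTS)⟩


/-! ### §8  Co-atoms (the mirror dictionary: atoms implied by ALICE's side) and the combined atom core

The complementary duty `Φᶜ`, `Φ = killSet H ∪ sepSet (D ∖ H)`: Bob's inside edges kill every colouring SATISFYING all the atoms
(`G[B]` plus the `≠`-atoms, `=`-atoms identified, is not 3-colourable) and Alice's edges kill every colouring violating one (the atoms are
implied by `G_A`).  Both dictionaries together cost a factor `2`; take `C = 6`. -/

/-- A CO-binary-atom certificate of size `≤ n/2` for `G` at `B` (duty = complement of the binary-atom duty). -/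
def HasCoBinaryCertificate {n : ℕ} (G : Finset (Sym2 (Fin n))) (B : Finset (Fin n)) : Prop :=
  ∃ D H : Finset (Sym2 (Fin n)), H ⊆ D ∧ 2 * D.card ≤ n ∧
    (∀ c ∉ killSet H ∪ sepSet (D \ H), c ∈ killSet (bobSide B G)) ∧
    (∀ c ∈ killSet H ∪ sepSet (D \ H), c ∈ killSet (aliceSide B G))

theorem HasCoBinaryCertificate.mono {n : ℕ} {T G : Finset (Sym2 (Fin n))} {B : Finset (Fin n)}
    (h : HasCoBinaryCertificate T B) (hTG : T ⊆ G) : HasCoBinaryCertificate G B := by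
  obtain ⟨D, H, hHD, hcard, hB, hA⟩ := h
  exact ⟨D, H, hHD, hcard, fun c hc => killSet_mono (bobSide_mono B hTG) (hB c hc),
    fun c hc => killSet_mono (aliceSide_mono B hTG) (hA c hc)⟩

/-- **ATOM CORE (both dictionaries).**  Every loopless non-3-colourable edge set over `Fin n` has a cut of size `⌈n/2⌉` carrying a
binary-atom certificate OR a co-binary-atom certificate of size `≤ n/2`. -/
def AtomCore : Prop :=
  ∀ (n : ℕ) (G : Finset (Sym2 (Fin n))), (∀ e ∈ G, ¬ e.IsDiag) → ¬ Col3 G →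
    ∃ B : Finset (Fin n), n ≤ 2 * B.card ∧ 2 * B.card ≤ n + 1 ∧
      (HasBinaryCertificate G B ∨ HasCoBinaryCertificate G B)

/-- `AtomCore` restricted to 4-edge-critical edge sets. -/
def AtomCoreCrit : Prop :=
  ∀ (n : ℕ) (G : Finset (Sym2 (Fin n))), IsEdgeCritical G →
    ∃ B : Finset (Fin n), n ≤ 2 * B.card ∧ 2 * B.card ≤ n + 1 ∧
      (HasBinaryCertificate G B ∨ HasCoBinaryCertificate G B)

theorem atomCore_of_binaryAtomCore (h : BinaryAtomCore) : AtomCore := by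
  intro n G hl hc
  obtain ⟨B, h1, h2, hcert⟩ := h n G hl hc
  exact ⟨B, h1, h2, Or.inl hcert⟩

theorem atomCore_of_crit (h : AtomCoreCrit) : AtomCore := by
  intro n G hl hc
  obtain ⟨T, hTG, hT⟩ := exists_critical_subset G hl hc
  obtain ⟨B, h1, h2, hcert⟩ := h n T hT
  refine ⟨B, h1, h2, ?_⟩
  rcases hcert with h' | h'
  · exact Or.inl (h'.mono hTG)
  · exact Or.inr (h'.mono hTG)

/-- `2^{-(n/2)·log₂ n - 6n} = 2^{-(n/2)·log₂ n - 4n} · 2^{-2n}`. -/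
theorem delta_six_eq (n : ℕ) :
    (2 : ℝ) ^ (-((n : ℝ) / 2 * Real.logb 2 n) - ((6 : ℕ) : ℝ) * n) =
      (2 : ℝ) ^ (-((n : ℝ) / 2 * Real.logb 2 n) - ((4 : ℕ) : ℝ) * n) * (2 : ℝ) ^ (-(2 * (n : ℝ))) := by
  rw [← Real.rpow_add (by norm_num : (0 : ℝ) < 2)]
  congr 1
  push_cast
  ring

/-- The duty attached to a dictionary index `((D, H), b)`: the binary-atom duty for `b = true`, its complement for `b = false`. -/
def atomDuty {n : ℕ} (i : (Finset (Sym2 (Fin n)) × Finset (Sym2 (Fin n))) × Bool) : Set (Fin n → Fin 3) :=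
  if i.2 then killSet i.1.2 ∪ sepSet (i.1.1 \ i.1.2) else (killSet i.1.2 ∪ sepSet (i.1.1 \ i.1.2))ᶜ

/-- **Finite core, combined form** (`C = 6`). -/
theorem exists_atom_uncertified_support {n : ℕ} (hn : 2 ≤ n) (μ : Finset (Sym2 (Fin n)) → ℝ)
    (hμ : ∀ S, 0 ≤ μ S) (hsum : ∑ S, μ S = 1)
    (hs : ∀ S, μ S ≠ 0 → (∀ e ∈ S, ¬ e.IsDiag) ∧ ¬ Col3 S)
    (hX : ∀ B : Finset (Fin n), n ≤ 2 * B.card → 2 * B.card ≤ n + 1 →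
      RectClause μ B ((2 : ℝ) ^ (-((n : ℝ) / 2 * Real.logb 2 n) - ((6 : ℕ) : ℝ) * n))) :
    ∃ S, μ S ≠ 0 ∧ ∀ B : Finset (Fin n), n ≤ 2 * B.card → 2 * B.card ≤ n + 1 →
      ¬ HasBinaryCertificate S B ∧ ¬ HasCoBinaryCertificate S B := by
  classical
  by_contra hall
  push Not at hall
  set δ : ℝ := (2 : ℝ) ^ (-((n : ℝ) / 2 * Real.logb 2 n) - ((6 : ℕ) : ℝ) * n) with hδ
  have hδpos : 0 < δ := Real.rpow_pos_of_pos (by norm_num) _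
  set m : ℕ := n / 2 with hm
  set P : Finset (Finset (Sym2 (Fin n))) := univ.filter (fun D => D.card ≤ m) with hP
  set J : Finset (Finset (Sym2 (Fin n)) × Finset (Sym2 (Fin n))) :=
    P.biUnion (fun D => D.powerset.image (fun H => (D, H))) with hJ
  set Wset : Finset (Finset (Fin n)) := univ.filter (fun B => n ≤ 2 * B.card ∧ 2 * B.card ≤ n + 1) with hW
  set I := Wset ×ˢ (J ×ˢ (univ : Finset Bool)) with hI
  have hcov : ∀ S, μ S ≠ 0 → ∃ i ∈ I, S ∈ dutyRect i.1 (atomDuty i.2) := by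
    intro S hS
    obtain ⟨B, h1, h2, hc⟩ := hall S hS
    have hBW : B ∈ Wset := mem_filter.2 ⟨mem_univ _, h1, h2⟩
    by_cases hb : HasBinaryCertificate S B
    · obtain ⟨D, H, hHD, hcard, hB', hA'⟩ := hb
      have hJm : (D, H) ∈ J := by
        rw [hJ, mem_biUnion]
        exact ⟨D, mem_filter.2 ⟨mem_univ _, (show D.card ≤ m by omega)⟩,
          mem_image.2 ⟨H, mem_powerset.2 hHD, rfl⟩⟩
      refine ⟨(B, ((D, H), true)), mem_product.2 ⟨hBW, mem_product.2 ⟨hJm, mem_univ _⟩⟩, ?_⟩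
      exact mem_dutyRect_iff_killSet.2 ⟨(hs S hS).1, by simpa [atomDuty] using hB', by simpa [atomDuty] using hA'⟩
    · obtain ⟨D, H, hHD, hcard, hB', hA'⟩ := hc hb
      have hJm : (D, H) ∈ J := by
        rw [hJ, mem_biUnion]
        exact ⟨D, mem_filter.2 ⟨mem_univ _, (show D.card ≤ m by omega)⟩,
          mem_image.2 ⟨H, mem_powerset.2 hHD, rfl⟩⟩
      refine ⟨(B, ((D, H), false)), mem_product.2 ⟨hBW, mem_product.2 ⟨hJm, mem_univ _⟩⟩, ?_⟩
      refine mem_dutyRect_iff_killSet.2 ⟨(hs S hS).1, ?_, ?_⟩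
      · intro c hc
        simp only [atomDuty, Bool.false_eq_true, if_false, Set.mem_compl_iff] at hc
        exact hB' c hc
      · intro c hc
        simp only [atomDuty, Bool.false_eq_true, if_false, Set.mem_compl_iff, not_not] at hc
        exact hA' c hc
  have htot := total_le_of_dutyCover μ hμ I Prod.fst (fun i => atomDuty i.2)
    (fun i hi => by
      obtain ⟨hB, -⟩ := mem_product.1 hi
      obtain ⟨-, h1, h2⟩ := mem_filter.1 hB
      exact hX i.1 h1 h2) hcov
  rw [hsum] at htot
  have hWc : Wset.card ≤ 2 ^ n := by
    calc Wset.card ≤ (univ : Finset (Finset (Fin n))).card := card_le_card (filter_subset _ _)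
      _ = 2 ^ n := by rw [card_univ, Fintype.card_finset, Fintype.card_fin]
  have hPc : P.card ≤ (n / 2 + 1) * (Fintype.card (Sym2 (Fin n))).choose (n / 2) :=
    card_filter_card_le_choose (Sym2 (Fin n)) m
      ((show 2 * m ≤ n by omega).trans (le_card_sym2_fin (by omega)))
  have hJc : J.card ≤ P.card * 2 ^ m := by
    calc J.card ≤ ∑ D ∈ P, (D.powerset.image (fun H => (D, H))).card := card_biUnion_le
      _ ≤ ∑ _D ∈ P, 2 ^ m := by
          refine sum_le_sum fun D hD => ?_
          calc (D.powerset.image (fun H => (D, H))).card ≤ D.powerset.card := card_image_le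
            _ = 2 ^ D.card := card_powerset D
            _ ≤ 2 ^ m := Nat.pow_le_pow_right (by norm_num) (mem_filter.1 hD).2
      _ = P.card * 2 ^ m := by rw [sum_const, smul_eq_mul]
  have hIcard : (I.card : ℝ) ≤ ((2 ^ n : ℕ) : ℝ) *
      (((n / 2 + 1) * (Fintype.card (Sym2 (Fin n))).choose (n / 2) : ℕ) : ℝ) * (((2 ^ m * 2 : ℕ)) : ℝ) := by
    rw [hI, card_product, card_product, card_univ, Fintype.card_bool]
    have : Wset.card * (J.card * 2) ≤
        2 ^ n * (((n / 2 + 1) * (Fintype.card (Sym2 (Fin n))).choose (n / 2)) * (2 ^ m * 2)) := by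
      refine Nat.mul_le_mul hWc ?_
      calc J.card * 2 ≤ P.card * 2 ^ m * 2 := Nat.mul_le_mul_right _ hJc
        _ ≤ (n / 2 + 1) * (Fintype.card (Sym2 (Fin n))).choose (n / 2) * 2 ^ m * 2 :=
            Nat.mul_le_mul_right _ (Nat.mul_le_mul_right _ hPc)
        _ = _ := by ring
    have := (Nat.cast_le (α := ℝ)).2 this
    push_cast at this ⊢
    linarith
  have hlt := halfSparse_count_lt_one hn
  have hmn : ((2 ^ m * 2 : ℕ) : ℝ) * (2 : ℝ) ^ (-(2 * (n : ℝ))) ≤ 1 := by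
    have h1 : ((2 ^ m * 2 : ℕ) : ℝ) = (2 : ℝ) ^ (((m + 1 : ℕ)) : ℝ) := by
      rw [Real.rpow_natCast]; push_cast; ring
    rw [h1, ← Real.rpow_add (by norm_num : (0 : ℝ) < 2)]
    calc (2 : ℝ) ^ (((m + 1 : ℕ) : ℝ) + -(2 * (n : ℝ))) ≤ (2 : ℝ) ^ (0 : ℝ) :=
          Real.rpow_le_rpow_of_exponent_le (by norm_num) (by
            have : ((m + 1 : ℕ) : ℝ) ≤ 2 * n := by exact_mod_cast (show m + 1 ≤ 2 * n by omega)
            linarith)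
      _ = 1 := Real.rpow_zero _
  have hδeq : δ = (2 : ℝ) ^ (-((n : ℝ) / 2 * Real.logb 2 n) - ((4 : ℕ) : ℝ) * n) * (2 : ℝ) ^ (-(2 * (n : ℝ))) :=
    delta_six_eq n
  set δ₄ : ℝ := (2 : ℝ) ^ (-((n : ℝ) / 2 * Real.logb 2 n) - ((4 : ℕ) : ℝ) * n) with hδ₄
  have hδ₄pos : 0 < δ₄ := Real.rpow_pos_of_pos (by norm_num) _
  have h2n : 0 < (2 : ℝ) ^ (-(2 * (n : ℝ))) := Real.rpow_pos_of_pos (by norm_num) _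
  set A : ℝ := ((2 ^ n : ℕ) : ℝ) * (((n / 2 + 1) * (Fintype.card (Sym2 (Fin n))).choose (n / 2) : ℕ) : ℝ) with hA
  have hApos : 0 ≤ A := by positivity
  have key : (I.card : ℝ) * δ ≤ (A * δ₄) * (((2 ^ m * 2 : ℕ) : ℝ) * (2 : ℝ) ^ (-(2 * (n : ℝ)))) := by
    rw [hδeq]
    have := mul_le_mul_of_nonneg_right hIcard (mul_pos hδ₄pos h2n).le
    calc (I.card : ℝ) * (δ₄ * (2 : ℝ) ^ (-(2 * (n : ℝ))))
        ≤ A * ((2 ^ m * 2 : ℕ) : ℝ) * (δ₄ * (2 : ℝ) ^ (-(2 * (n : ℝ)))) := this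
      _ = (A * δ₄) * (((2 ^ m * 2 : ℕ) : ℝ) * (2 : ℝ) ^ (-(2 * (n : ℝ)))) := by ring
  have hfin : (A * δ₄) * (((2 ^ m * 2 : ℕ) : ℝ) * (2 : ℝ) ^ (-(2 * (n : ℝ)))) < 1 := by
    calc (A * δ₄) * (((2 ^ m * 2 : ℕ) : ℝ) * (2 : ℝ) ^ (-(2 * (n : ℝ)))) ≤ (A * δ₄) * 1 :=
          mul_le_mul_of_nonneg_left hmn (mul_nonneg hApos hδ₄pos.le)
      _ < 1 := by rw [mul_one, hA, mul_assoc]; exact hlt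
  linarith

/-- **X1 IS FALSE UNDER THE COMBINED ATOM-CORE HYPOTHESIS** — the widest rung of this file:
`HalfSparseCore → ImpliedHalfSparseCore → BinaryAtomCore → AtomCore → ¬ FoolingMeasure`. -/
theorem foolingMeasure_false_of_atomCore (hH : AtomCore) :
    ¬ Summit.PneNP.PneNP.Theses.AeaCutRectangles.FoolingMeasure := by
  intro hX1
  obtain ⟨n, -, hn2, μ, hμ, hsum, hs, hX⟩ := foolingMeasure_schedule hX1 6 0
  obtain ⟨S, hS, hno⟩ := exists_atom_uncertified_support hn2 μ hμ hsum hs hX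
  obtain ⟨B, h1, h2, hcert⟩ := hH n S (hs S hS).1 (hs S hS).2
  rcases hcert with h | h
  · exact (hno B h1 h2).1 h
  · exact (hno B h1 h2).2 h

theorem foolingMeasure_false_of_atomCoreCrit (hH : AtomCoreCrit) :
    ¬ Summit.PneNP.PneNP.Theses.AeaCutRectangles.FoolingMeasure :=
  foolingMeasure_false_of_atomCore (atomCore_of_crit hH)

/-- **Kill path (stmt-PneNP-19729) under the combined atom core.** -/
theorem noFoolingMeasure_of_atomCore (hH : AtomCore) :
    Summit.PneNP.PneNP.Theses.AeaCutRectangles.NoFoolingMeasure := by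
  unfold Summit.PneNP.PneNP.Theses.AeaCutRectangles.NoFoolingMeasure
  exact foolingMeasure_false_of_atomCore hH

theorem noFoolingMeasure_of_atomCoreCrit (hH : AtomCoreCrit) :
    Summit.PneNP.PneNP.Theses.AeaCutRectangles.NoFoolingMeasure :=
  noFoolingMeasure_of_atomCore (atomCore_of_crit hH)

/-- **Design requirement, combined form**: X1 forces, for infinitely many `n`, 4-edge-critical graphs on `Fin n` admitting NEITHER a
binary-atom NOR a co-binary-atom certificate of size `≤ n/2` at any cut of size `⌈n/2⌉`. -/
theorem foolingMeasure_imp_atomIncompressible'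
    (hX1 : Summit.PneNP.PneNP.Theses.AeaCutRectangles.FoolingMeasure) (N : ℕ) :
    ∃ n, N ≤ n ∧ ∃ T : Finset (Sym2 (Fin n)), IsEdgeCritical T ∧
      ∀ B : Finset (Fin n), n ≤ 2 * B.card → 2 * B.card ≤ n + 1 →
        ¬ HasBinaryCertificate T B ∧ ¬ HasCoBinaryCertificate T B := by
  obtain ⟨n, hnN, hn2, μ, hμ, hsum, hs, hX⟩ := foolingMeasure_schedule hX1 6 N
  obtain ⟨S, hS, hno⟩ := exists_atom_uncertified_support hn2 μ hμ hsum hs hX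
  obtain ⟨T, hTS, hT⟩ := exists_critical_subset S (hs S hS).1 (hs S hS).2
  exact ⟨n, hnN, T, hT, fun B h1 h2 =>
    ⟨fun hc => (hno B h1 h2).1 (hc.mono hTS), fun hc => (hno B h1 h2).2 (hc.mono hTS)⟩⟩

end Summit.PneNP.PneNP.Cruxes.FoolingMeasure.P4g12
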